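import Mathlib
import Summits.PneNP.PneNP.Theorems.PstarGapLemma
import Summits.PneNP.PneNP.Theorems.PstarSAClosure
import Summits.PneNP.PneNP.Theorems.PstarGapPeeling
import Summits.PneNP.PneNP.Theorems.PstarGapSupport
import Summits.PneNP.PneNP.Theorems.PstarMinInfeasibleElim
import Summits.PneNP.PneNP.Theorems.PstarNoDeadCentre
import Summits.PneNP.PneNP.Theorems.PstarChordRepair
import Summits.PneNP.PneNP.Theorems.PstarCentreFree

/-!
# Three kills for one AND-typed parity: flips that reach the forbidden parity (ROUND-24, tools for T24.16)

FRONTIER range-avoidance ladder (cell `pnp-ideate`, ROUND-24 gap-lemma programme; restricted-model combinatorics — nothing here bears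
on `P` versus `NP`).

Setting of `PstarNoDeadCentre.GapOneAnd`: a pure typed instance, one parity `(C, b)` on AND-type variables, a minimal
`{(C,b)}`-infeasible `J`, and a solution `z` of `J`.  Each KILL produces a solution of `J` with parity `b` (impossible, `no_solution`)
by an XOR flip followed by `PstarChordRepair.repair_chords` on the chords the flip violates (they sit at `(1,1)`, `chord_true`):
* `kill_all_chords` — flip an XOR slot all of whose readers in `J` are chords;
* `kill_double` — flip both XOR slots of an output `f` whose other readers are chords (simple overlaps: no chord reads both, so each is
  toggled once and `f` twice);
* `kill_tip` — flip an XOR slot of `f` whose other readers are chords and repair `f` through a `J`-private AND slot `ℓ ∉ C` whose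
  partner is active (`eval_toggle_and_true`).
Also: reader bookkeeping (`exists_other_reader`, `eq_of_bdry`), the typed slot dictionary (`and_slot_of_mem_varSet`,
`and_slot_not_mem_chord`: no chord reads an AND slot of another output), and the AND-slot toggles.
-/

set_option linter.dupNamespace false -- `Summit.PneNP.PneNP.…`: summit = sub-problem name (D-0017 single-conjunct layout)

open Finset Literature.Computability.Complexity
open Summit.PneNP.PneNP.Theorems.PstarPDT (parity)
open Summit.PneNP.PneNP.Theorems.PstarTyped (Typed)
open Summit.PneNP.PneNP.Theorems.PstarSALevel (varSet bdry BoundaryExpanding SimpleOverlap)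
open Summit.PneNP.PneNP.Theorems.PstarGapLemma (Sat Feasible MinInfeasible)
open Summit.PneNP.PneNP.Theorems.PstarGapPeeling (not_mem_varSet_of_private eval_update_of_not_mem eval_pure)
open Summit.PneNP.PneNP.Theorems.PstarGapSupport (parity_update_of_notMem)
open Summit.PneNP.PneNP.Theorems.PstarGapLinearised (andPair)
open Summit.PneNP.PneNP.Theorems.PstarNoDeadCentre (IsCentre IsAndVar)
open Summit.PneNP.PneNP.Theorems.PstarChordRepair
open Summit.PneNP.PneNP.Theorems.PstarCentreFree (vars_mem_varSet centreFree)

namespace Summit.PneNP.PneNP.Theorems.PstarGapOneKills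

variable {n m : ℕ}

/-! ## Degrees and boundaries -/

/-- A variable read by `f ∈ J` that is not `J`-boundary is read by another output of `J`. -/
theorem exists_other_reader (I : LocalMap 4 n m) {J : Finset (Fin m)} {f : Fin m} (hf : f ∈ J) {v : Fin n} (hv : v ∈ varSet I f)
    (hnb : v ∉ bdry I J) : ∃ g ∈ J, g ≠ f ∧ v ∈ varSet I g := by
  classical
  by_contra hno
  push Not at hno
  apply hnb
  unfold PstarSALevel.bdry
  rw [mem_filter, card_eq_one]
  refine ⟨mem_univ _, f, ?_⟩
  ext g
  rw [mem_filter, mem_singleton]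
  constructor
  · rintro ⟨hg, hvg⟩
    by_contra hne
    exact hno g hg hne hvg
  · rintro rfl
    exact ⟨hf, hv⟩

/-- A boundary variable of `N` is read by only one output of `N`. -/
theorem eq_of_bdry (I : LocalMap 4 n m) {N : Finset (Fin m)} {v : Fin n} (hv : v ∈ bdry I N) {f g : Fin m} (hf : f ∈ N)
    (hg : g ∈ N) (hvf : v ∈ varSet I f) (hvg : v ∈ varSet I g) : f = g := by
  classical
  unfold PstarSALevel.bdry at hv
  rw [mem_filter, card_eq_one] at hv
  obtain ⟨a, ha⟩ := hv.2
  have h1 : f ∈ ({a} : Finset (Fin m)) := ha ▸ mem_filter.2 ⟨hf, hvf⟩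
  have h2 : g ∈ ({a} : Finset (Fin m)) := ha ▸ mem_filter.2 ⟨hg, hvg⟩
  rw [mem_singleton] at h1 h2
  rw [h1, h2]

/-- On a typed instance an AND-slot variable is read by an output only through its AND slots. -/
theorem and_slot_of_mem_varSet (I : LocalMap 4 n m) (hT : Typed I) {f : Fin m} {s₀ : Fin 4} (hs₀ : 2 ≤ s₀.val) {j : Fin m}
    (h : I.vars f s₀ ∈ varSet I j) : ∃ s : Fin 4, 2 ≤ s.val ∧ I.vars j s = I.vars f s₀ := by
  unfold PstarSALevel.varSet at h
  obtain ⟨s, -, hs⟩ := mem_image.1 h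
  refine ⟨s, ?_, hs⟩
  by_contra hlt
  push Not at hlt
  exact hT j f s s₀ hlt hs₀ hs

/-- An AND-slot variable of an output lies in its AND pair. -/
theorem mem_andPair_of_slot (I : LocalMap 4 n m) (j : Fin m) (s : Fin 4) (hs : 2 ≤ s.val) : I.vars j s ∈ andPair I j := by
  unfold PstarGapLinearised.andPair
  have : s = 2 ∨ s = 3 := by fin_cases s <;> simp at hs ⊢
  rcases this with rfl | rfl <;> simp

/-- **No chord reads an AND slot of another output** (typed): the chord's AND slots are private. -/
theorem and_slot_not_mem_chord (I : LocalMap 4 n m) (hT : Typed I) {J : Finset (Fin m)} {f c : Fin m} (hf : f ∈ J) (hc : c ∈ J)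
    (hch : IsChord I J c) (hne : c ≠ f) (s : Fin 4) (hs : 2 ≤ s.val) : I.vars f s ∉ varSet I c := by
  intro h
  obtain ⟨s', hs', hse⟩ := and_slot_of_mem_varSet I hT hs h
  have hb : I.vars c s' ∈ bdry I J := by
    have : s' = 2 ∨ s' = 3 := by fin_cases s' <;> simp at hs' ⊢
    rcases this with rfl | rfl
    · exact hch.1
    · exact hch.2
  exact not_mem_varSet_of_private I hc hf hne.symm hb (vars_mem_varSet I c s') (hse ▸ vars_mem_varSet I f s)

/-- Two distinct XOR slots are `{0, 1}`. -/
theorem lt2_pair : ∀ s s' : Fin 4, s.val < 2 → s'.val < 2 → s ≠ s' → (s = 0 ∧ s' = 1) ∨ (s = 1 ∧ s' = 0) := by decide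

/-- Two distinct AND slots are `{2, 3}`. -/
theorem ge2_pair : ∀ s s' : Fin 4, 2 ≤ s.val → 2 ≤ s'.val → s ≠ s' → (s = 2 ∧ s' = 3) ∨ (s = 3 ∧ s' = 2) := by decide

/-! ## AND-slot toggles -/

/-- Toggling one AND slot while the other is `true` toggles the output. -/
theorem eval_toggle_and_true (I : LocalMap 4 n m) (hI : I.IsPure xorAndPred) (z : Fin n → Bool) (j : Fin m) {sl sd : Fin 4}
    (hsl : sl = 2 ∧ sd = 3 ∨ sl = 3 ∧ sd = 2) (hd : z (I.vars j sd) = true) :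
    I.eval (Function.update z (I.vars j sl) (!z (I.vars j sl))) j = !I.eval z j := by
  have hinj := hI.2 j
  have hne : ∀ t t' : Fin 4, t ≠ t' → I.vars j t ≠ I.vars j t' := fun t t' ht h => ht (hinj h)
  rw [eval_pure I hI, eval_pure I hI]
  rcases hsl with ⟨rfl, rfl⟩ | ⟨rfl, rfl⟩
  · rw [Function.update_of_ne (hne 0 2 (by decide)), Function.update_of_ne (hne 1 2 (by decide)),
      Function.update_of_ne (hne 3 2 (by decide)), Function.update_self, hd]
    cases z (I.vars j 0) <;> cases z (I.vars j 1) <;> cases z (I.vars j 2) <;> rfl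
  · rw [Function.update_of_ne (hne 0 3 (by decide)), Function.update_of_ne (hne 1 3 (by decide)),
      Function.update_of_ne (hne 2 3 (by decide)), Function.update_self, hd]
    cases z (I.vars j 0) <;> cases z (I.vars j 1) <;> cases z (I.vars j 3) <;> rfl

/-- Changing one AND slot while the other is `false` does not move the output. -/
theorem eval_set_and_false (I : LocalMap 4 n m) (hI : I.IsPure xorAndPred) (z : Fin n → Bool) (j : Fin m) {sl sd : Fin 4}
    (hsl : sl = 2 ∧ sd = 3 ∨ sl = 3 ∧ sd = 2) (hd : z (I.vars j sd) = false) (a : Bool) :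
    I.eval (Function.update z (I.vars j sl) a) j = I.eval z j := by
  have hinj := hI.2 j
  have hne : ∀ t t' : Fin 4, t ≠ t' → I.vars j t ≠ I.vars j t' := fun t t' ht h => ht (hinj h)
  rw [eval_pure I hI, eval_pure I hI]
  rcases hsl with ⟨rfl, rfl⟩ | ⟨rfl, rfl⟩
  · rw [Function.update_of_ne (hne 0 2 (by decide)), Function.update_of_ne (hne 1 2 (by decide)),
      Function.update_of_ne (hne 3 2 (by decide)), Function.update_self, hd]
    cases a <;> cases z (I.vars j 2) <;> rfl
  · rw [Function.update_of_ne (hne 0 3 (by decide)), Function.update_of_ne (hne 1 3 (by decide)),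
      Function.update_of_ne (hne 2 3 (by decide)), Function.update_self, hd, Bool.false_and, Bool.false_and]

/-! ## The three kills -/

section Kills

variable (I : LocalMap 4 n m) (hI : I.IsPure xorAndPred) (hT : Typed I) {y : Fin m → Bool} {C : Finset (Fin n)} {b : Bool}
  {J : Finset (Fin m)} (hC : ∀ v ∈ C, IsAndVar I v) (hmin : MinInfeasible I y {(C, b)} J)

include hmin in
/-- No solution of `J` has the parity `b`. -/
theorem no_solution {z : Fin n → Bool} (hz : ∀ j ∈ J, I.eval z j = y j) (hb : parity C z = b) : False :=
  hmin.1 ⟨z, (sat_singleton_iff C b z).2 hb, hz⟩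

include hC in
/-- XOR-slot variables are outside `C`. -/
theorem xor_slot_not_mem_C (j : Fin m) (s : Fin 4) (hs : s.val < 2) : I.vars j s ∉ C :=
  fun h => not_isAndVar_xor_slot I j s hs (hC _ h)

include hT in
/-- Flipping an XOR-slot variable does not touch AND slots (typed). -/
theorem flip_and_slot (z : Fin n → Bool) (f : Fin m) (s₀ : Fin 4) (hs₀ : s₀.val < 2) (a : Bool) (j : Fin m) (s : Fin 4)
    (hs : 2 ≤ s.val) : Function.update z (I.vars f s₀) a (I.vars j s) = z (I.vars j s) :=
  Function.update_of_ne (fun h => hT f j s₀ s hs₀ hs h.symm) _ _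

include hI hT hC hmin in
/-- **Kill (a)**: flip an XOR slot all of whose readers in `J` are chords. -/
theorem kill_all_chords {z : Fin n → Bool} (hz : ∀ j ∈ J, I.eval z j = y j) {f : Fin m} (hf : f ∈ J) (s₀ : Fin 4)
    (hs₀ : s₀.val < 2) (hall : ∀ j ∈ J, I.vars f s₀ ∈ varSet I j → IsChord I J j) : False := by
  classical
  set z₁ := Function.update z (I.vars f s₀) (!z (I.vars f s₀)) with hz₁
  set Q := J.filter fun j => I.vars f s₀ ∈ varSet I j with hQ
  have hQJ : Q ⊆ J := filter_subset _ _
  have hpar₁ : parity C z₁ = parity C z := parity_update_of_notMem (xor_slot_not_mem_C I hC f s₀ hs₀) z _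
  obtain ⟨z', hz', hb'⟩ := repair_chords I hI hmin Q z₁ hQJ (fun j hj => hall j (hQJ hj) (mem_filter.1 hj).2)
    (fun j hj => by
      obtain ⟨hjJ, htj⟩ := mem_filter.1 hj
      obtain ⟨h2, h3⟩ := chord_true I hI hmin hz hjJ (hall j hjJ htj)
      refine ⟨?_, ?_, ?_⟩
      · rw [hz₁, eval_flip_of_mem I hI hT hs₀ z htj, hz j hjJ]
        cases y j <;> simp
      · rw [hz₁, flip_and_slot I hT z f s₀ hs₀ _ j 2 (by decide)]; exact h2
      · rw [hz₁, flip_and_slot I hT z f s₀ hs₀ _ j 3 (by decide)]; exact h3)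
    (fun j hj hnQ => by
      have htj : I.vars f s₀ ∉ varSet I j := fun h => hnQ (mem_filter.2 ⟨hj, h⟩)
      rw [hz₁, eval_flip_of_not_mem I z htj, hz j hj])
    b (Or.inl ⟨f, mem_filter.2 ⟨hf, vars_mem_varSet I f s₀⟩⟩)
  exact no_solution I hmin hz' hb'

include hI hT hC hmin in
/-- **Kill (b)**: flip BOTH XOR slots of an output `f` all of whose other readers are chords (with simple overlaps no chord reads both,
so each is toggled once while `f` is toggled twice). -/
theorem kill_double (hS : SimpleOverlap I) {z : Fin n → Bool} (hz : ∀ j ∈ J, I.eval z j = y j) {f : Fin m} (hf : f ∈ J)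
    (hall : ∀ j ∈ J, j ≠ f → (I.vars f 0 ∈ varSet I j ∨ I.vars f 1 ∈ varSet I j) → IsChord I J j)
    (hex : ∃ j ∈ J, j ≠ f ∧ (I.vars f 0 ∈ varSet I j ∨ I.vars f 1 ∈ varSet I j)) : False := by
  classical
  set t := I.vars f 0 with ht
  set t' := I.vars f 1 with ht'
  set z₁ := Function.update z t (!z t) with hz₁
  set z₂ := Function.update z₁ t' (!z₁ t') with hz₂
  set Q := J.filter fun j => j ≠ f ∧ (t ∈ varSet I j ∨ t' ∈ varSet I j) with hQ
  have hQJ : Q ⊆ J := filter_subset _ _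
  have htt' : t ≠ t' := fun h => absurd (hI.2 f h) (by decide)
  have hpar₂ : parity C z₂ = parity C z := by
    rw [hz₂, parity_update_of_notMem (xor_slot_not_mem_C I hC f 1 (by decide)), hz₁,
      parity_update_of_notMem (xor_slot_not_mem_C I hC f 0 (by decide))]
  -- no chord reads both `t` and `t'`
  have hone : ∀ j ∈ J, j ≠ f → IsChord I J j → ¬ (t ∈ varSet I j ∧ t' ∈ varSet I j) := by
    rintro j hj hne - ⟨h0, h1⟩
    have h2 : 2 ≤ (varSet I j ∩ varSet I f).card := by
      have hsub : ({t, t'} : Finset (Fin n)) ⊆ varSet I j ∩ varSet I f := by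
        intro v hv
        rw [mem_insert, mem_singleton] at hv
        rcases hv with rfl | rfl
        · exact mem_inter.2 ⟨h0, vars_mem_varSet I f 0⟩
        · exact mem_inter.2 ⟨h1, vars_mem_varSet I f 1⟩
      have := card_le_card hsub
      rwa [card_pair htt'] at this
    have := hS j f hne
    omega
  have hAND : ∀ (j : Fin m) (s : Fin 4), 2 ≤ s.val → z₂ (I.vars j s) = z (I.vars j s) := by
    intro j s hs
    rw [hz₂, flip_and_slot I hT z₁ f 1 (by decide) _ j s hs, hz₁, flip_and_slot I hT z f 0 (by decide) _ j s hs]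
  obtain ⟨z', hz', hb'⟩ := repair_chords I hI hmin Q z₂ hQJ
    (fun j hj => by
      obtain ⟨hjJ, hne, hor⟩ := mem_filter.1 hj
      exact hall j hjJ hne hor)
    (fun j hj => by
      obtain ⟨hjJ, hne, hor⟩ := mem_filter.1 hj
      have hch := hall j hjJ hne hor
      obtain ⟨h2, h3⟩ := chord_true I hI hmin hz hjJ hch
      have hnot := hone j hjJ hne hch
      refine ⟨?_, by rw [hAND j 2 (by decide)]; exact h2, by rw [hAND j 3 (by decide)]; exact h3⟩
      rcases hor with h0 | h1
      · have h1 : t' ∉ varSet I j := fun h1 => hnot ⟨h0, h1⟩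
        rw [hz₂, eval_flip_of_not_mem I z₁ h1, hz₁, ht, eval_flip_of_mem I hI hT (show (0 : Fin 4).val < 2 by decide) z h0,
          hz j hjJ]
        cases y j <;> simp
      · have h0 : t ∉ varSet I j := fun h0 => hnot ⟨h0, h1⟩
        rw [hz₂, ht', eval_flip_of_mem I hI hT (show (1 : Fin 4).val < 2 by decide) z₁ h1, hz₁, eval_flip_of_not_mem I z h0,
          hz j hjJ]
        cases y j <;> simp)
    (fun j hj hnQ => by
      by_cases hjf : j = f
      · subst hjf
        rw [hz₂, ht', eval_flip_of_mem I hI hT (show (1 : Fin 4).val < 2 by decide) z₁ (vars_mem_varSet I j 1), hz₁, ht,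
          eval_flip_of_mem I hI hT (show (0 : Fin 4).val < 2 by decide) z (vars_mem_varSet I j 0), hz j hj, Bool.not_not]
      · have hno : ¬ (t ∈ varSet I j ∨ t' ∈ varSet I j) := fun h => hnQ (mem_filter.2 ⟨hj, hjf, h⟩)
        push Not at hno
        rw [hz₂, eval_flip_of_not_mem I z₁ hno.2, hz₁, eval_flip_of_not_mem I z hno.1, hz j hj])
    b (Or.inl (by
      obtain ⟨j, hj, hne, hor⟩ := hex
      exact ⟨j, mem_filter.2 ⟨hj, hne, hor⟩⟩))
  exact no_solution I hmin hz' hb'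

include hI hT hC hmin in
/-- **Kill (c)**: flip an XOR slot `t` of `f` whose other readers are chords, and repair `f` through a `J`-private AND slot `ℓ ∉ C`
whose partner is active. -/
theorem kill_tip {z : Fin n → Bool} (hz : ∀ j ∈ J, I.eval z j = y j) {f : Fin m} (hf : f ∈ J) (s₀ : Fin 4) (hs₀ : s₀.val < 2)
    {sl sd : Fin 4} (hsl : sl = 2 ∧ sd = 3 ∨ sl = 3 ∧ sd = 2) (hℓb : I.vars f sl ∈ bdry I J) (hℓC : I.vars f sl ∉ C)
    (hd : z (I.vars f sd) = true) (hall : ∀ j ∈ J, j ≠ f → I.vars f s₀ ∈ varSet I j → IsChord I J j)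
    (hex : ∃ j ∈ J, j ≠ f ∧ I.vars f s₀ ∈ varSet I j) : False := by
  classical
  set t := I.vars f s₀ with ht
  set ℓ := I.vars f sl with hℓ
  set z₁ := Function.update z t (!z t) with hz₁
  set z₂ := Function.update z₁ ℓ (!z₁ ℓ) with hz₂
  set Q := J.filter fun j => j ≠ f ∧ t ∈ varSet I j with hQ
  have hQJ : Q ⊆ J := filter_subset _ _
  have hsl2 : 2 ≤ sl.val := by rcases hsl with ⟨rfl, -⟩ | ⟨rfl, -⟩ <;> decide
  have hsd2 : 2 ≤ sd.val := by rcases hsl with ⟨-, rfl⟩ | ⟨-, rfl⟩ <;> decide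
  have hpar₂ : parity C z₂ = parity C z := by
    rw [hz₂, parity_update_of_notMem hℓC, hz₁, parity_update_of_notMem (xor_slot_not_mem_C I hC f s₀ hs₀)]
  -- `ℓ` is private to `f`
  have hℓpriv : ∀ j ∈ J, j ≠ f → ℓ ∉ varSet I j := fun j hj hne =>
    not_mem_varSet_of_private I hf hj hne hℓb (vars_mem_varSet I f sl)
  obtain ⟨z', hz', hb'⟩ := repair_chords I hI hmin Q z₂ hQJ
    (fun j hj => by
      obtain ⟨hjJ, hne, htj⟩ := mem_filter.1 hj
      exact hall j hjJ hne htj)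
    (fun j hj => by
      obtain ⟨hjJ, hne, htj⟩ := mem_filter.1 hj
      have hch := hall j hjJ hne htj
      obtain ⟨h2, h3⟩ := chord_true I hI hmin hz hjJ hch
      have hℓj := hℓpriv j hjJ hne
      have hℓne : ∀ s : Fin 4, I.vars j s ≠ ℓ := fun s h => hℓj (h ▸ vars_mem_varSet I j s)
      refine ⟨?_, ?_, ?_⟩
      · rw [hz₂, eval_flip_of_not_mem I z₁ hℓj, hz₁, ht, eval_flip_of_mem I hI hT hs₀ z htj, hz j hjJ]
        cases y j <;> simp
      · rw [hz₂, Function.update_of_ne (hℓne 2), hz₁, flip_and_slot I hT z f s₀ hs₀ _ j 2 (by decide)]; exact h2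
      · rw [hz₂, Function.update_of_ne (hℓne 3), hz₁, flip_and_slot I hT z f s₀ hs₀ _ j 3 (by decide)]; exact h3)
    (fun j hj hnQ => by
      by_cases hjf : j = f
      · subst hjf
        have hd₁ : z₁ (I.vars j sd) = true := by rw [hz₁, flip_and_slot I hT z j s₀ hs₀ _ j sd hsd2]; exact hd
        rw [hz₂, hℓ, eval_toggle_and_true I hI z₁ j hsl hd₁, hz₁, ht, eval_flip_of_mem I hI hT hs₀ z (vars_mem_varSet I j s₀),
          hz j hj, Bool.not_not]
      · have htj : t ∉ varSet I j := fun h => hnQ (mem_filter.2 ⟨hj, hjf, h⟩)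
        rw [hz₂, eval_flip_of_not_mem I z₁ (hℓpriv j hj hjf), hz₁, eval_flip_of_not_mem I z htj, hz j hj])
    b (Or.inl (by
      obtain ⟨j, hj, hne, htj⟩ := hex
      exact ⟨j, mem_filter.2 ⟨hj, hne, htj⟩⟩))
  exact no_solution I hmin hz' hb'

end Kills

end Summit.PneNP.PneNP.Theorems.PstarGapOneKills
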